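import Summits.AnomalousDissipation.AnomalousDissipation.Theses.LandauJetArena
import HarnessLib

/-!
# Route LandauJetArena — the support glue `FloorAndFamilyGiveTarget`

Proof of the route declaration
`Summit.AnomalousDissipation.AnomalousDissipation.Theses.LandauJetArena.FloorAndFamilyGiveTarget`
(item stmt-AnomalousDissipation-1545): the jet-pair dissipation floor (crux r2,
`JetPairDissipationFloor`) together with a bounded-energy vanishing-viscosity family for some
jet-pair configuration (crux r4, `JetPairBoundedEnergyFamily`) gives the route target
`JetPairZerothLaw` (the zeroth law restricted to push–pull jet-pair forces).

This is pure logic. Take the configuration `(ρ, a, φ, f)`, the energy level `E` and the family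
`(ν, u₀, u)` from the family hypothesis; the floor at that configuration and that `E` gives
`ε > 0` and `ν₀ > 0`; since `ν j → 0` there is `J` with `ν j ≤ ν₀` for all `j ≥ J`; the reindexed
family `j ↦ j + J` is still a vanishing-viscosity family of global Leray–Hopf solutions driven by
`f` with mean energies `≤ E`, and the floor applies to every member, giving mean dissipation `≥ ε`.
-/

namespace Summit.AnomalousDissipation.AnomalousDissipation.Theorems

-- the mandated namespace `Summit.<Summit>.<Problem>.Theorems` repeats `AnomalousDissipation` (single-problem summit)
set_option linter.dupNamespace false

open Filter Topology
open Summit.AnomalousDissipation.AnomalousDissipation.Theses.LandauJetArena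

/-- **Floor and family give the target.** `JetPairDissipationFloor → JetPairBoundedEnergyFamily →
JetPairZerothLaw`, in the expanded form of the route declaration `FloorAndFamilyGiveTarget`:
take the configuration `(ρ, a, φ, f)`, the level `E` and the family `(ν, u₀, u)` from the family
hypothesis; the floor at that configuration and `E` gives `ε > 0`, `ν₀ > 0`; `Tendsto ν atTop (𝓝 0)`
gives `J` with `ν j ≤ ν₀` for `j ≥ J` (`Tendsto.eventually` + `eventually_atTop`); reindex
`j ↦ j + J` (`tendsto_add_atTop_nat`), keep the energy bound `E`, and apply the floor to every
reindexed member. Closes item stmt-AnomalousDissipation-1545. -/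
theorem FloorAndFamilyGiveTarget_proof :
    Summit.AnomalousDissipation.AnomalousDissipation.Theses.LandauJetArena.FloorAndFamilyGiveTarget := by
  unfold FloorAndFamilyGiveTarget
  intro hFloor hFam
  obtain ⟨ρ, a, φ, f, hcfg, E, ν, u₀, u, hν, hT, hLH, hE⟩ := hFam
  obtain ⟨ε, hε, ν₀, hν₀, hfl⟩ := hFloor ρ a φ f hcfg E
  obtain ⟨J, hJ⟩ := eventually_atTop.1 (hT.eventually (Iic_mem_nhds hν₀))
  refine ⟨ρ, a, φ, f, hcfg, fun j => ν (j + J), fun j => u₀ (j + J), fun j => u (j + J),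
    fun j => hν (j + J), hT.comp (tendsto_add_atTop_nat J), fun j => hLH (j + J),
    ⟨E, fun j => hE (j + J)⟩, ε, hε, fun j => ?_⟩
  exact hfl (ν (j + J)) (u₀ (j + J)) (u (j + J)) (hν (j + J)) (hJ (j + J) (Nat.le_add_left J j))
    (hLH (j + J)) (hE (j + J))

end Summit.AnomalousDissipation.AnomalousDissipation.Theorems
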